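import Mathlib
import Summits.Ventures.HodgeRepro.Tier4.Line1.InstanceType
import Summits.Ventures.HodgeRepro.Tier4.Line1.IsotypicIdempotentGlue
import Summits.Ventures.HodgeRepro.Tier4.Line1.IsolatingTestsFiniteRankTypeBiInvariant
import Summits.Ventures.HodgeRepro.Tier4.Line1.RTFConclusionV3
import Summits.Ventures.HodgeRepro.Tier4.Line1.SpectralOfRTFIsolated
import Summits.Ventures.HodgeRepro.Tier4.Line1.RealisedSetting
import Summits.Ventures.HodgeRepro.Tier4.Line1.RationalPoints
import Summits.Ventures.HodgeRepro.Tier4.Line1.LocallyCompactGA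
import Summits.Ventures.HodgeRepro.Tier4.Line1.SecondCountableGA
import Summits.Ventures.HodgeRepro.Tier4.Line1.CocompactReduction

/-!
# Tier4/Line1/InstanceDisplay — C-L1-DISPLAY: the v3 residual of LINE L1 as a TREE theorem whose hypothesis is the
DISPLAY ITSELF (the K-type `σ`, `hlift`, the seesaw identity (S1a), `hM`, `hPA`, `hPA'`, `hreal`), everything else by name

Blind re-derivation cell `pub-hodge-repro`, Tier 4 (README §9–§10), seat t4-L1-p5 (prover, LINE L1, gen 4); the cut
C-L1-DISPLAY named by t4-plan-1 g3 (STATUS S14628), taken S14629.  Target tree path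
`lean/Summits/Ventures/HodgeRepro/Tier4/Line1/InstanceDisplay.lean`.

WHAT IS HERE (three steps, all PROVED by name on landed modules; no printed input is consumed, no `sorry`).
1. `hne_of_hPA` — the (C-NZ) clause `hne` of the type-σ block is IMPLIED by the test-vector clause `hPA` (a
   block-admissible vector of non-zero `χ`-period is a non-zero block vector of `τ m`; `periodT χ 0 = 0`), generic over
   any `RTF.Setting`; and `isolationRealised_isotypic''` — t4-L1-p5 g3's `isolationRealised_isotypic'`
   (IsotypicIdempotentGlue p694521) WITHOUT the clause `hne`: (S3″) for the type-σ block from `hM`, `hPA`, `hPA'`,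
   `hreal` alone.
2. `isolationRealised_ofAdelic_instance` — (S3″) ON L1's INSTANCE: the adelic setting `Setting.ofAdelic pl hdef hgen R μ
   hT hT'` (RealisedSetting) with the compact open `K := finLevel pl N` (open: `isOpen_finLevel`; compact on a totally
   definite plane: `isCompact_finLevel_of_totallyDefinite`) and the K-type `ρ := instanceType pl N σ = σ ∘ pr_∞`
   (InstanceType p694766) of a continuous unitary irreducible `σ` of `pr_∞(K_f(N) × U(W)(k_∞))`; the instance facts
   `U(W)(k)` countable (`rationalPoints_countable`), `U(W)(𝔸_k)` second countable / Hausdorff / locally compact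
   (`secondCountable_GA`, `t2Space_GA`, `locallyCompact_GA`), Haar `μ` s-finite (`sfinite_ofAdelic_μ`) are supplied BY
   NAME — the tree declares no instance (typer lint), so the support of the block and its constituents are packaged as
   the definitions `instanceSupport` / `instanceCore` (= `isotypicSupport` / the core of `isotypicConstituent` at the
   instance with the instance facts written in; `instanceSupport_def` is `rfl`).
3. `P_T4v3_of_instance_displayed` — THE THEOREM: `P_T4v3` (the successor target, TargetV3) from the hypothesis that
   for every datum `d` there are a deeper level `Γ'`, lifts `a'` into the same tori with `N2`, cocompactness `hcc`,
   a totally definite genuine plane `pl` with its RTF data `R`, Haar measure `μ`, the two continuous unitary corner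
   characters, and, FOR EVERY DEFINED BLOCK (adapted ONB `τ φ n`, level `N ≠ 0`, isolating pair `f₁ f₂ o₀` with `f₁`
   of finite-rank left-`finLevel pl N`-type and bi-`levelK pl N`-invariant — the block t4-L1-p4's
   `defined_inputs_realisable_finiteRankType_biInvariant_of_totallyDefinite` PROVIDES on such a plane), a lift clause
   `Lift` with `hlift`, Hecke test pairs `tf` on the translates of the re-levelled concrete witness, and a K-type `σ`
   with: `hlift` (F1+F2 for the given `f₁`), the SEESAW IDENTITY (S1a) `HodgePairingEqJ` ALONE, multiplicity one of
   the cores on the support `hM`, the test-vector clauses `hPA` / `hPA'`, and the Hecke dictionary `hreal`.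
   PROOF, all by name: p4's defined block → the displayed `∃` → t4-L1-p1 g3's packer `P_T4v3_of_rtf_isolated`
   (RTFConclusionV3) with the characters `isCharacter_ofAdelic` / `isCharacter'_ofAdelic`, (S1″) from
   `spectralIdentificationAt_iff_J` (SpectralOfRTFIsolated: at an isolating pair the `m`-block IS `J`) and (S3″) from
   step 2.

WHY IT IS THE CUT (plan-1 S14628).  It is the first TREE statement of L1's whole v3 residual whose hypothesis is the
display itself, with no `SpectralIdentificationAt` / `IsolationRealised` black box: the kernel tally moves from «the
skeleton says» to «the tree says».  SHARPENING of the line's CENSUS §B rows (4)+(5), recorded here as the docstring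
of step 3: the v3 assembly consumes the seesaw identity (S1a) ALONE — no (S1b) Hecke finiteness, no finite spectrum,
no left-type clause of the Hecke pairs enters it (`spectralIdentificationAt_iff_J` reads the identification at the
isolating translate only).  What stays DISPLAYED (the residual of record, nothing proved about it here): the level,
the lifts with `N2`, `hcc`, the corner characters, `Lift`/`hlift`, the Hecke pairs `tf` with (S1a), `σ`, `hM`,
`hPA`/`hPA'`, `hreal`.  Nothing of the costumes is touched and `P_T4v3` is not moved: the theorem DISPLAYS the
residual, it does not discharge it.

DESIGN NOTES (disclosed for the critics' binder-by-binder read).  (i) The `∀ τ φ n N f₁ f₂ o₀, clauses → ∃ …` shape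
quantifies over EVERY defined block of the plane — faithful to «the block the theorem provides», and the proof feeds it
p4's block.  (ii) The K-type's three clauses `hσc hσu hσirr` are `∃`-bound (not `∧`-conjuncts) because the support
`instanceSupport` and the cores of the constituents `instanceCore` DEPEND on them (they are arguments of `isotypicSupport` /
`isotypicConstituent`); `∧` is not dependent.  (iii) `σ` lives on `archImageLevel pl N` after `N` is known — no
transport.  (iv) The test clauses of `tf` are displayed because `spectralIdentificationAt_iff_J` asks them.  (v) The
four character clauses (`R.chi`, `R.chi'` continuous and unimodular) are anonymous `∃`-binders: they are consumed by
the proof (`isCharacter_ofAdelic` / `isCharacter'_ofAdelic`), not by the display that follows them.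
Nothing here says anything about the status of the Hodge conjecture for CM abelian varieties, which is NOT proved
(HC_CM is NOT proved by anyone in this repository).
-/

set_option autoImplicit false

noncomputable section

namespace Summit.Ventures.HodgeRepro.Tier4.Line1

open MeasureTheory Topology NumberField Common RTF

section Generic

/-- **THE (C-NZ) CLAUSE `hne` IS IMPLIED BY THE TEST-VECTOR CLAUSE `hPA`**: a block-admissible vector `w` of `τ m` in
the block `Vb` with `periodT χ w ≠ 0` is a non-zero block vector of `τ m` (`periodT χ 0 = 0`).  So `hne` is not an
independent displayed clause of row (6): the display is `hM`, `hPA`, `hPA'`, `hreal` and the instance. -/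
theorem hne_of_hPA {G : Type} [Group G] [TopologicalSpace G] [MeasurableSpace G] (S : RTF.Setting G)
    (χ : S.T → ℂ) (χ' : S.T' → ℂ) (τ : ℕ → Set (G → ℂ)) (Vb : Submodule ℂ (G → ℂ))
    (hPA : ∀ m, S.PeriodNonzeroT χ (τ m) →
      ∃ w ∈ RTF.Setting.blockAdmissible τ m Vb, S.periodT χ (fun t => w t) ≠ 0) :
    ∀ m, S.PeriodNonzeroT χ (τ m) → S.PeriodNonzeroT' χ' (τ m) → ∃ ψ ∈ Vb, ψ ∈ τ m ∧ ψ ≠ 0 := by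
  intro m hT _
  obtain ⟨w, ⟨hwV, hwτ⟩, hw⟩ := hPA m hT
  refine ⟨w, hwV, hwτ, ?_⟩
  rintro rfl
  exact hw S.periodT_zero

/-- **(S3″) FOR THE TYPE-σ BLOCK WITHOUT THE (C-NZ) CLAUSE**: t4-L1-p5 g3's `isolationRealised_isotypic'`
(IsotypicIdempotentGlue p694521) with `hne := hne_of_hPA` — `IsolationRealised` from multiplicity one of the cores on
the support `hM`, the test-vector clauses `hPA` / `hPA'` and the dictionary `hreal` alone.  `Lift` is not used. -/
theorem isolationRealised_isotypic'' {Form : Type} [AddCommGroup Form] [Module ℂ Form] {A : FormAlgebra Form}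
    {W : Witness A} {G : Type} [Group G] [TopologicalSpace G] [IsTopologicalGroup G] [MeasurableSpace G]
    [BorelSpace G] (S : RTF.Setting G) (χ : S.T → ℂ) (χ' : S.T' → ℂ) (τ : ℕ → Set (G → ℂ)) (Lift : ℕ → Prop)
    (φ : ℕ → G → ℂ) (n : ℕ → ℕ) (tf : W.Translates → (G → ℂ) × (G → ℂ)) (K : Subgroup G) {d : ℕ}
    (ρ : K →* Matrix (Fin d) (Fin d) ℂ) (hKo : IsOpen (K : Set G)) (hKc : IsCompact (K : Set G))
    (hρ : Continuous ρ) (hirr : RTF.Setting.IsIrreducibleRep ρ) [Countable S.Gk] [MeasurableMul G]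
    [SecondCountableTopology G] [T2Space G] [SFinite S.μ] [LocallyCompactSpace G]
    (hu : RTF.Setting.IsUnitaryRep ρ) (hB : S.IsAdaptedONB τ φ n)
    (hM : ∀ i j : ↥(RTF.Setting.isotypicSupport S K ρ hKo hKc hρ hu hB), i ≠ j →
      ¬ S.IsoRep
        (S.core (RTF.Setting.isotypicConstituent S K ρ hKo hKc hρ hirr τ hB.inv
          (RTF.Setting.isotypicSupport S K ρ hKo hKc hρ hu hB)
          (fun _ hm => RTF.Setting.exists_ne_zero_of_mem_isotypicSupport S K ρ hKo hKc hρ hu hB hm) i))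
        (S.core (RTF.Setting.isotypicConstituent S K ρ hKo hKc hρ hirr τ hB.inv
          (RTF.Setting.isotypicSupport S K ρ hKo hKc hρ hu hB)
          (fun _ hm => RTF.Setting.exists_ne_zero_of_mem_isotypicSupport S K ρ hKo hKc hρ hu hB hm) j)))
    (hPA : ∀ m, S.PeriodNonzeroT χ (τ m) →
      ∃ w ∈ RTF.Setting.blockAdmissible τ m (RTF.Setting.isotypicFixed S K ρ hKo hKc hρ),
        S.periodT χ (fun t => w t) ≠ 0)
    (hPA' : ∀ m, S.PeriodNonzeroT' χ' (τ m) →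
      ∃ w' ∈ RTF.Setting.blockAdmissible τ m (RTF.Setting.isotypicFixed S K ρ hKo hKc hρ),
        S.periodT' χ' (fun t' => w' t') ≠ 0)
    (hreal : RealisedHecke S χ χ' φ n tf (RTF.Setting.HeckeAlg S K ρ hKo hKc hρ hirr) (fun t => (t : G → ℂ))) :
    IsolationRealised S χ χ' τ Lift φ n tf :=
  isolationRealised_isotypic' S χ χ' τ Lift φ n tf K ρ hKo hKc hρ hirr hu hB
    (hne_of_hPA S χ χ' τ (RTF.Setting.isotypicFixed S K ρ hKo hKc hρ) hPA) hM hPA hPA' hreal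

end Generic

section Instance

variable {k : Type} [Field k] [NumberField k] (pl : PlaneData k) (hdef : IsDefinite pl) (hgen : IsGenuineRow pl)
  [MeasurableSpace (GA pl)] [BorelSpace (GA pl)] (R : RTFData pl) (μ : Measure (GA pl)) [μ.IsHaarMeasure]
  [R.μT.IsHaarMeasure] [R.μT'.IsHaarMeasure] (hT : IsCompact (closure R.DT)) (hT' : IsCompact (closure R.DT'))

/-- the adelic setting's Haar measure is `μ` (`rfl`), hence s-finite: Haar on a second countable locally compact group
(LocallyCompactGA, SecondCountableGA). -/
theorem sfinite_ofAdelic_μ : SFinite (Setting.ofAdelic pl hdef hgen R μ hT hT').μ := by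
  haveI : LocallyCompactSpace (GA pl) := locallyCompact_GA pl
  haveI : SecondCountableTopology (GA pl) := secondCountable_GA pl
  exact (inferInstance : SFinite μ)

/-- the adelic setting's discrete group is `U(W)(k)` (`rfl`), countable (CocompactReduction
`rationalPoints_countable`). -/
theorem countable_ofAdelic_Gk : Countable (Setting.ofAdelic pl hdef hgen R μ hT hT').Gk :=
  rationalPoints_countable pl

variable (htot : IsTotallyDefinite pl) {N : ℕ} (hN : N ≠ 0) {d : ℕ}
  (σ : archImageLevel pl N →* Matrix (Fin d) (Fin d) ℂ) (hσc : Continuous σ) (hσu : ∀ u, (σ u).conjTranspose * σ u = 1)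
  (hσirr : ∀ U : Submodule ℂ (Fin d → ℂ), (∀ u, ∀ v ∈ U, (σ u).mulVec v ∈ U) → U = ⊥ ∨ U = ⊤)
  {τ : ℕ → Set (GA pl → ℂ)} {φ : ℕ → GA pl → ℂ} {n : ℕ → ℕ}
  (hB : (Setting.ofAdelic pl hdef hgen R μ hT hT').IsAdaptedONB τ φ n)

/-- **the support of the type-σ block of L1's instance**: `isotypicSupport` (IsotypicIdempotentGlue) on the adelic
setting at `K := finLevel pl N`, `ρ := instanceType pl N σ`, with the countability of `U(W)(k)` written in by name
(`rationalPoints_countable pl`; the tree declares no instance). -/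
def instanceSupport : Finset ℕ :=
  haveI : Countable (Setting.ofAdelic pl hdef hgen R μ hT hT').Gk := rationalPoints_countable pl
  RTF.Setting.isotypicSupport (Setting.ofAdelic pl hdef hgen R μ hT hT') (finLevel pl N) (instanceType pl N σ)
    (isOpen_finLevel pl hN) (isCompact_finLevel_of_totallyDefinite pl htot hN) (continuous_instanceType pl N σ hσc)
    (isUnitaryRep_instanceType pl N σ hσu) hB

/-- `instanceSupport` IS `isotypicSupport` at the instance (`rfl`; the countability instance spelled out). -/
theorem instanceSupport_def :
    instanceSupport pl hdef hgen R μ hT hT' htot hN σ hσc hσu hB =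
      @RTF.Setting.isotypicSupport (GA pl) _ _ _ _ _ (Setting.ofAdelic pl hdef hgen R μ hT hT') (finLevel pl N) d
        (instanceType pl N σ) (isOpen_finLevel pl hN) (isCompact_finLevel_of_totallyDefinite pl htot hN)
        (continuous_instanceType pl N σ hσc) (isUnitaryRep_instanceType pl N σ hσu) (rationalPoints_countable pl)
        τ φ n hB :=
  rfl

/-- **the algebraic core of the constituent of the type-σ block at a support index**: `S.core` of
`isotypicConstituent` (IsotypicIdempotentData) on the adelic setting at the instance — the `H_σ`-submodule of the block
at the index `i` of `instanceSupport`, its core the invariant subspace generated by it (IsotypicBernstein `core`) —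
with the instance facts (countable `U(W)(k)`, second countable / Hausdorff `U(W)(𝔸_k)`, s-finite Haar `μ`; they make
`H_σ` a ring and the block an `H_σ`-module) supplied by name. -/
def instanceCore (i : ↥(instanceSupport pl hdef hgen R μ hT hT' htot hN σ hσc hσu hB)) :
    Submodule ℂ (GA pl → ℂ) :=
  haveI : Countable (Setting.ofAdelic pl hdef hgen R μ hT hT').Gk := rationalPoints_countable pl
  haveI : SecondCountableTopology (GA pl) := secondCountable_GA pl
  haveI : T2Space (GA pl) := t2Space_GA pl
  haveI : SFinite (Setting.ofAdelic pl hdef hgen R μ hT hT').μ := sfinite_ofAdelic_μ pl hdef hgen R μ hT hT'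
  (Setting.ofAdelic pl hdef hgen R μ hT hT').core
    (RTF.Setting.isotypicConstituent (Setting.ofAdelic pl hdef hgen R μ hT hT') (finLevel pl N) (instanceType pl N σ)
      (isOpen_finLevel pl hN) (isCompact_finLevel_of_totallyDefinite pl htot hN) (continuous_instanceType pl N σ hσc)
      (isIrreducibleRep_instanceType pl N σ hσirr) τ hB.inv
      (instanceSupport pl hdef hgen R μ hT hT' htot hN σ hσc hσu hB)
      (fun _ hm => RTF.Setting.exists_ne_zero_of_mem_isotypicSupport (Setting.ofAdelic pl hdef hgen R μ hT hT')
        (finLevel pl N) (instanceType pl N σ) (isOpen_finLevel pl hN)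
        (isCompact_finLevel_of_totallyDefinite pl htot hN) (continuous_instanceType pl N σ hσc)
        (isUnitaryRep_instanceType pl N σ hσu) hB hm) i)

/-- **(S3″) ON L1's INSTANCE WITH THE DECOMPOSITION DISCHARGED AND WITHOUT THE (C-NZ) CLAUSE**: `IsolationRealised`
for the adelic setting of a totally definite genuine plane at level `N ≠ 0` with the K-type `ρ := σ ∘ pr_∞` of
`K := finLevel pl N` (InstanceType p694766), from `isolationRealised_isotypic''`.  DISPLAYED in row (6), and nothing
else: the K-type `σ` (continuous, unitary, irreducible — the corner forms' archimedean type, data of the line),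
multiplicity one of the cores on the support `hM`, the test-vector clauses `hPA` / `hPA'` (Rallis' non-vanishing IN
the block), and the dictionary `hreal` (geometric Hecke ↔ `H_σ`).  `Lift` is not used. -/
theorem isolationRealised_ofAdelic_instance {Form : Type} [AddCommGroup Form] [Module ℂ Form]
    {A : FormAlgebra Form} {Wt : Witness A} (Lift : ℕ → Prop) (tf : Wt.Translates → (GA pl → ℂ) × (GA pl → ℂ))
    (hM : ∀ i j : ↥(instanceSupport pl hdef hgen R μ hT hT' htot hN σ hσc hσu hB), i ≠ j →
      ¬ (Setting.ofAdelic pl hdef hgen R μ hT hT').IsoRep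
        (instanceCore pl hdef hgen R μ hT hT' htot hN σ hσc hσu hσirr hB i)
        (instanceCore pl hdef hgen R μ hT hT' htot hN σ hσc hσu hσirr hB j))
    (hPA : ∀ m, (Setting.ofAdelic pl hdef hgen R μ hT hT').PeriodNonzeroT R.chi (τ m) →
      ∃ w ∈ RTF.Setting.blockAdmissible τ m (RTF.Setting.isotypicFixed (Setting.ofAdelic pl hdef hgen R μ hT hT')
        (finLevel pl N) (instanceType pl N σ) (isOpen_finLevel pl hN)
        (isCompact_finLevel_of_totallyDefinite pl htot hN) (continuous_instanceType pl N σ hσc)),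
        (Setting.ofAdelic pl hdef hgen R μ hT hT').periodT R.chi (fun t => w t) ≠ 0)
    (hPA' : ∀ m, (Setting.ofAdelic pl hdef hgen R μ hT hT').PeriodNonzeroT' R.chi' (τ m) →
      ∃ w' ∈ RTF.Setting.blockAdmissible τ m (RTF.Setting.isotypicFixed (Setting.ofAdelic pl hdef hgen R μ hT hT')
        (finLevel pl N) (instanceType pl N σ) (isOpen_finLevel pl hN)
        (isCompact_finLevel_of_totallyDefinite pl htot hN) (continuous_instanceType pl N σ hσc)),
        (Setting.ofAdelic pl hdef hgen R μ hT hT').periodT' R.chi' (fun t' => w' t') ≠ 0)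
    (hreal : RealisedHecke (Setting.ofAdelic pl hdef hgen R μ hT hT') R.chi R.chi' φ n tf
      (RTF.Setting.HeckeAlg (Setting.ofAdelic pl hdef hgen R μ hT hT') (finLevel pl N) (instanceType pl N σ)
        (isOpen_finLevel pl hN) (isCompact_finLevel_of_totallyDefinite pl htot hN)
        (continuous_instanceType pl N σ hσc) (isIrreducibleRep_instanceType pl N σ hσirr))
      (fun t => (t : GA pl → ℂ))) :
    IsolationRealised (Setting.ofAdelic pl hdef hgen R μ hT hT') R.chi R.chi' τ Lift φ n tf := by
  haveI : Countable (Setting.ofAdelic pl hdef hgen R μ hT hT').Gk := rationalPoints_countable pl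
  haveI : SecondCountableTopology (GA pl) := secondCountable_GA pl
  haveI : T2Space (GA pl) := t2Space_GA pl
  haveI : LocallyCompactSpace (GA pl) := locallyCompact_GA pl
  haveI : SFinite (Setting.ofAdelic pl hdef hgen R μ hT hT').μ := sfinite_ofAdelic_μ pl hdef hgen R μ hT hT'
  exact isolationRealised_isotypic'' (Setting.ofAdelic pl hdef hgen R μ hT hT') R.chi R.chi' τ Lift φ n tf
    (finLevel pl N) (instanceType pl N σ) (isOpen_finLevel pl hN) (isCompact_finLevel_of_totallyDefinite pl htot hN)
    (continuous_instanceType pl N σ hσc) (isIrreducibleRep_instanceType pl N σ hσirr)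
    (isUnitaryRep_instanceType pl N σ hσu) hB hM hPA hPA' hreal

end Instance

section Packer

/-- **THE v3 RESIDUAL OF LINE L1 AS A TREE THEOREM, ITS HYPOTHESIS THE DISPLAY ITSELF** (C-L1-DISPLAY): `P_T4v3` from
— for every datum `d` — a deeper level `Γ'`, lifts `a'` into the same tori with `N2`, cocompactness `hcc` at `Γ'`, a
totally definite genuine plane `pl` over a number field `k` with its RTF data `R` (Haar measures, compact torus
domains), a Haar measure `μ` on `U(W)(𝔸_k)`, the two continuous unitary corner characters `R.chi`, `R.chi'`, and, for
EVERY defined block of the plane (an adapted ONB `τ φ n`, a level `N ≠ 0`, an isolating test pair `f₁ f₂` with the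
geometric support `{o₀}`, a non-zero orbital term, `f₁` of finite-rank left-`finLevel pl N`-type and bi-`levelK pl N`-
invariant — the block `defined_inputs_realisable_finiteRankType_biInvariant_of_totallyDefinite` provides), the DISPLAY:
a lift clause `Lift` with `hlift` (F1+F2 for the given `f₁`), Hecke test pairs `tf` on the translates of the
re-levelled concrete witness, a K-type `σ` of `pr_∞(K_f(N) × U(W)(k_∞))` (continuous, unitary, irreducible), the
SEESAW IDENTITY (S1a) `HodgePairingEqJ` — and nothing else of (S1′): the v3 assembly reads the identification at the
isolating translate only (`spectralIdentificationAt_iff_J`), so no (S1b) Hecke finiteness, no finite spectrum and no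
left-type clause of the Hecke pairs is displayed (the sharpening of CENSUS §B rows (4)+(5)) —, multiplicity one of the
cores on the support `hM`, the test-vector clauses `hPA` / `hPA'`, and the dictionary `hreal` (geometric Hecke ↔
`H_σ`).  The theorem DISPLAYS the residual, it does not discharge it: nothing of the costumes is touched, `P_T4v3` is
not moved.  The K-type's clauses are `∃`-bound because the support and the constituents depend on them. -/
theorem P_T4v3_of_instance_displayed
    (h : ∀ (F E : Type) [Field F] [NumberField F] [IsGalois ℚ F] [IsCMField F]
      [Field E] [NumberField E] [IsGalois ℚ E] [IsCMField E] (d : TargetData F E),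
      ∃ (Γ' : Set (Matrix (Fin 3) (Fin 3) E)) (hΓ' : d.IsLevel Γ') (a' : ∀ i : Fin 4, (Fin 2 → ℂ) → (↥(d.T i) → ℂ))
        (ha' : ∀ i, IsAlbaneseLift (d.T i) (d.Λ i) d.τ₀ d.C Γ' (a' i)),
        (d.relevel Γ' hΓ'.1 a' ha').N2 ∧
        ∃ hcc : (d.relevel Γ' hΓ'.1 a' ha').IsCocompact Γ',
        ∃ (k : Type) (_ : Field k) (_ : NumberField k) (pl : PlaneData k) (hdef : IsDefinite pl)
          (hgen : IsGenuineRow pl) (_ : MeasurableSpace (GA pl)) (_ : BorelSpace (GA pl)) (R : RTFData pl)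
          (μ : Measure (GA pl)) (_ : μ.IsHaarMeasure) (_ : R.μT.IsHaarMeasure) (_ : R.μT'.IsHaarMeasure)
          (hT : IsCompact (closure R.DT)) (hT' : IsCompact (closure R.DT')) (htot : IsTotallyDefinite pl)
          (_ : Continuous R.chi) (_ : ∀ a, ‖R.chi a‖ = 1) (_ : Continuous R.chi') (_ : ∀ a, ‖R.chi' a‖ = 1),
          ∀ (τ : ℕ → Set (GA pl → ℂ)) (φ : ℕ → GA pl → ℂ) (n : ℕ → ℕ) (N : ℕ) (f₁ f₂ : GA pl → ℂ)
            (o₀ : (Setting.ofAdelic pl hdef hgen R μ hT hT').Orbit)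
            (hB : (Setting.ofAdelic pl hdef hgen R μ hT hT').IsAdaptedONB τ φ n) (hN : N ≠ 0),
            RTF.IsTest f₁ → RTF.IsTest f₂ → RTF.IsTest ((Setting.ofAdelic pl hdef hgen R μ hT hT').conv f₁ f₂) →
            (Setting.ofAdelic pl hdef hgen R μ hT hT').geoSupport
              ((Setting.ofAdelic pl hdef hgen R μ hT hT').conv f₁ f₂) = {o₀} →
            (Setting.ofAdelic pl hdef hgen R μ hT hT').orbital R.chi R.chi' o₀
              ((Setting.ofAdelic pl hdef hgen R μ hT hT').conv f₁ f₂) ≠ 0 →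
            RTF.HasFiniteRankLeftType (finLevel pl N) f₁ →
            (∀ k ∈ levelK pl N, ∀ x, f₁ (x * k) = f₁ x ∧ f₁ (k * x) = f₁ x) →
            ∃ (Lift : ℕ → Prop)
              (tf : ((d.relevel Γ' hΓ'.1 a' ha').concreteWitness (d.relevel Γ' hΓ'.1 a' ha').isLevel_self
                (isDomain_dom _ (d.relevel Γ' hΓ'.1 a' ha').isLevel_self).subset_ball
                (isDomain_dom _ (d.relevel Γ' hΓ'.1 a' ha').isLevel_self).measurableSet
                ((d.relevel Γ' hΓ'.1 a' ha').residual_of_cocompact (d.relevel Γ' hΓ'.1 a' ha').isLevel_self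
                  hcc)).Translates → (GA pl → ℂ) × (GA pl → ℂ))
              (dσ : ℕ) (σ : archImageLevel pl N →* Matrix (Fin dσ) (Fin dσ) ℂ) (hσc : Continuous σ)
              (hσu : ∀ u, (σ u).conjTranspose * σ u = 1)
              (hσirr : ∀ U : Submodule ℂ (Fin dσ → ℂ), (∀ u, ∀ v ∈ U, (σ u).mulVec v ∈ U) → U = ⊥ ∨ U = ⊤),
              (∀ γ, RTF.IsTest (tf γ).1) ∧ (∀ γ, RTF.IsTest (tf γ).2) ∧
              (∀ m, (Setting.ofAdelic pl hdef hgen R μ hT hT').PeriodNonzeroT R.chi (τ m) →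
                (Setting.ofAdelic pl hdef hgen R μ hT hT').PeriodNonzeroT' R.chi' (τ m) →
                (Setting.ofAdelic pl hdef hgen R μ hT hT').Hit (RTF.cj f₁) (τ m) → Lift m) ∧
              HodgePairingEqJ (Setting.ofAdelic pl hdef hgen R μ hT hT') R.chi R.chi' tf ∧
              (∀ i j : ↥(instanceSupport pl hdef hgen R μ hT hT' htot hN σ hσc hσu hB), i ≠ j →
                ¬ (Setting.ofAdelic pl hdef hgen R μ hT hT').IsoRep
                  (instanceCore pl hdef hgen R μ hT hT' htot hN σ hσc hσu hσirr hB i)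
                  (instanceCore pl hdef hgen R μ hT hT' htot hN σ hσc hσu hσirr hB j)) ∧
              (∀ m, (Setting.ofAdelic pl hdef hgen R μ hT hT').PeriodNonzeroT R.chi (τ m) →
                ∃ w ∈ RTF.Setting.blockAdmissible τ m
                  (RTF.Setting.isotypicFixed (Setting.ofAdelic pl hdef hgen R μ hT hT') (finLevel pl N)
                    (instanceType pl N σ) (isOpen_finLevel pl hN) (isCompact_finLevel_of_totallyDefinite pl htot hN)
                    (continuous_instanceType pl N σ hσc)),
                  (Setting.ofAdelic pl hdef hgen R μ hT hT').periodT R.chi (fun t => w t) ≠ 0) ∧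
              (∀ m, (Setting.ofAdelic pl hdef hgen R μ hT hT').PeriodNonzeroT' R.chi' (τ m) →
                ∃ w' ∈ RTF.Setting.blockAdmissible τ m
                  (RTF.Setting.isotypicFixed (Setting.ofAdelic pl hdef hgen R μ hT hT') (finLevel pl N)
                    (instanceType pl N σ) (isOpen_finLevel pl hN) (isCompact_finLevel_of_totallyDefinite pl htot hN)
                    (continuous_instanceType pl N σ hσc)),
                  (Setting.ofAdelic pl hdef hgen R μ hT hT').periodT' R.chi' (fun t' => w' t') ≠ 0) ∧
              RealisedHecke (Setting.ofAdelic pl hdef hgen R μ hT hT') R.chi R.chi' φ n tf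
                (RTF.Setting.HeckeAlg (Setting.ofAdelic pl hdef hgen R μ hT hT') (finLevel pl N)
                  (instanceType pl N σ) (isOpen_finLevel pl hN) (isCompact_finLevel_of_totallyDefinite pl htot hN)
                  (continuous_instanceType pl N σ hσc) (isIrreducibleRep_instanceType pl N σ hσirr))
                (fun t => (t : GA pl → ℂ))) :
    P_T4v3 := by
  refine P_T4v3_of_rtf_isolated fun F E _ _ _ _ _ _ _ _ d => ?_
  obtain ⟨Γ', hΓ', a', ha', hN2, hcc, k, _, _, pl, hdef, hgen, _, _, R, μ, _, _, _, hT, hT', htot, hc, hu, hc', hu',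
    hall⟩ := h F E d
  obtain ⟨τ, φ, n, hB, N, f₁, f₂, o₀, hN, h₁, h₂, hconv, hiso, hne, htype, hinv⟩ :=
    defined_inputs_realisable_finiteRankType_biInvariant_of_totallyDefinite pl hdef hgen R μ hT hT' htot hc hu hc' hu'
  obtain ⟨Lift, tf, dσ, σ, hσc, hσu, hσirr, htf₁, htf₂, hlift, hJ, hM, hPA, hPA', hreal⟩ :=
    hall τ φ n N f₁ f₂ o₀ hB hN h₁ h₂ hconv hiso hne htype hinv
  have hχ : (Setting.ofAdelic pl hdef hgen R μ hT hT').IsCharacter R.chi :=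
    isCharacter_ofAdelic pl hdef hgen R μ hT hT' hc hu
  have hχ' : (Setting.ofAdelic pl hdef hgen R μ hT hT').IsCharacter' R.chi' :=
    isCharacter'_ofAdelic pl hdef hgen R μ hT hT' hc' hu'
  exact ⟨Γ', hΓ', a', ha', hN2, hcc, GA pl, inferInstance, inferInstance, inferInstance, inferInstance,
    inferInstance, Setting.ofAdelic pl hdef hgen R μ hT hT', R.chi, R.chi', τ, φ, n, f₁, f₂, o₀, Lift, tf, hχ, hχ',
    hB, h₁, h₂, hconv, hiso, hne, hlift,
    (spectralIdentificationAt_iff_J (Setting.ofAdelic pl hdef hgen R μ hT hT') R.chi R.chi' τ φ n tf hχ hχ' hB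
      htf₁ htf₂).2 (fun γ _ _ => hJ γ),
    isolationRealised_ofAdelic_instance pl hdef hgen R μ hT hT' htot hN σ hσc hσu hσirr hB Lift tf hM hPA hPA'
      hreal⟩

end Packer

end Summit.Ventures.HodgeRepro.Tier4.Line1

end
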